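import Summits.QuantumFields.YangMills.Theorems.FluctuationComparisonRegPrIntLS2BetaWhitneyHatLiftCurvatureSq
import Summits.QuantumFields.YangMills.Theorems.FluctuationComparisonRegPrIntLS2BetaSU2FourFactorRelative
import HarnessLib

/-!
# S2β · strata residue (H′) = {(D), (F)} of GAP♯∘ — (F3)-rel: THE RELATIVE CURVATURE OF TWO HAT LIFTS, ONE PLANE IN `ℓ²`:
# `Σ_x dist1((R_{μκ}Ṽ(x))⁻¹·R_{μκ}V(x))² ≤ (L⁻¹)⁴·L^d·(4·Σ_y dist1((R_{μκ}X̃(y))⁻¹·R_{μκ}X(y))² + C·(s+s̃)²·Σ_y ΣΔ²) + C′·(L⁻¹)²·(s+s̃)²·Σ_x Sd²` — FLUX-rel with the `L^{d−4}` gain + SIZE² × DIFFERENCE²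

Cell `ym3-torus` (rung R3 = continuum `SU(2)` Yang–Mills on the three-torus — NOT d = 4, NOT infinite volume, NOT a mass gap, NOT Clay).
Width seat «width 12» `ym3-torus-px12` (gen 23), FREE px helper on crux `stmt-QuantumFields-20520` (`Theses.UnitScaleTilt.FluctuationComparisonRegPrIntL`),
count-neutral, DEFINITION-FREE (lifts `V Ṽ` of `X X̃` pinned by the displayed formulas of ✓`…S2BetaWhitneyHatLift`).

WHAT IT IS FOR.  The lattice half of the commutator-defect letter (C1)-cov for px16 g20's (D) = REL-TEL road (✓`…S2BetaStrataOfLetters`): the two-tower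
recursion needs, per level and per plane, the relative plaquettes of the two LIFTS bounded by the relative plaquettes of the two COARSE fields (FLUX-rel, gain
`(L⁻¹)⁴·L^d = L⁻¹` at `d = 3`) plus SIZE² × DIFFERENCE² terms whose SIZE letter `s + s̃` (the two coarse levels' sup arcs) is geometric along the towers — (D)'s `ε_t`.
Inputs: ✓`…SU2FourFactorRelative` (chart: `dist1_plaq4_rel_le`, `norm_lincurl_sub_le_dist1_rel_add`), ✓`…WhitneyHatCurlSq.sum_sq_norm_lincurl_hat_le` (stated for a
GENERAL vector 1-form, so it eats the DIFFERENCE of the two exponent fields verbatim), ✓`…WhitneyHatLiftRelative` (`liftExponent_sub`, Jensen for the difference).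
* §1 ★★`dist1_rect_rel_lift_sq_le` — ONE FINE POSITION: `dist1(E_x)² ≤ 2‖dδ(x)‖² + 128·(L⁻¹)²·(s+s̃)²·Σ_{i=1}^4 ‖δ b_i‖²`, `δ b := a b − ã b` the exponent difference;
* §2 ★★`sq_norm_lincurl_rel_coarse_le` — ONE COARSE POSITION: `‖d(A − Ã)(y)‖² ≤ (L⁻¹)²·(2·dist1(E_y)² + 128·(s+s̃)²·Σ_{edges} ‖log X − log X̃‖²)`;
* §3 ★★★`sum_dist1_rect_rel_lift_sq_le` — ONE PLANE `μ ≠ κ` summed over the level (the displayed inequality, `C = 512`, `C′ = 256`);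
* §4 ★★★`sum_positions_dist1_rel_lift_sq_le` — ALL ORDERED POSITIONS `(x; μ ≠ κ)` (px13 g22's currency): `≤ (L⁻¹)⁴·L^d·(4·Σ_{(y;μ≠κ)} dist1(E_y)² + 1536·(d−1)·(s+s̃)²·Σ_e ‖Δ e‖²)`.

HONEST SCOPE.  Bookkeeping over the companions; nothing of Bałaban's analysis is asserted ([Balaban1985RegularSpaces] (1.29) p.81; [Balaban1985Variational] (34) p.283
loci only); (D), (F), `hIrr`, `hA`, TUBE-REG∘, GAP♯∘ (`stub_uniformFibreGapOrbit`), S2β, crux 20520 and `YM3TorusSU2` are NOT proved; no registered stub is closed;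
the Yang–Mills mass gap is NOT proved.
-/

set_option autoImplicit false

noncomputable section

namespace Summit.QuantumFields.YangMills.Theorems.FluctuationComparisonRegPrIntLS2BetaWhitneyHatLiftCurvatureRelative

open Finset
open scoped Real
open Literature.MathematicalPhysics.QuantumLattice (su2Quat)
open Literature.MathematicalPhysics.QuantumFieldTheory.Balaban1983to89
open B10Eq27TorusAxialLog (rel rel_apply)
open B10Eq47AxialChi (shiftN shiftN_zero shiftN_succ rowProd rect)
open T4CubeChartGnomonic (SU2)
open T4HaarSU2ExpChart (expPoint)
open T4ExpWindowSmallField (logVec expPoint_logVec)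
open Summit.QuantumFields.YangMills.Theorems.FluctuationComparisonRegPrIntLS2BetaWhitneyHatWeights (hatW_nonneg sum_hatW_eq_one sum_hatW_eq_pow)
open Summit.QuantumFields.YangMills.Theorems.FluctuationComparisonRegPrIntLS2BetaGeodesicJensenLift (norm_sum_smul_le_of_forall_le)
open Summit.QuantumFields.YangMills.Theorems.FluctuationComparisonRegPrIntLS2BetaSU2FourFactorRelative
  (dist1_plaq4_rel_le norm_lincurl_sub_le_dist1_rel_add)
open Summit.QuantumFields.YangMills.Theorems.FluctuationComparisonRegPrIntLS2BetaWhitneyHatCurlSq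
  (sum_sq_norm_lincurl_hat_le sum_four_slots_eq sum_pairs_add_eq sum_positions_eq)
open Summit.QuantumFields.YangMills.Theorems.FluctuationComparisonRegPrIntLS2BetaWhitneyHatLiftCurvatureSq (rect_one_one_eq)
open Summit.QuantumFields.YangMills.Theorems.FluctuationComparisonRegPrIntLS2BetaWhitneyHatLiftRelative (liftExponent_sub sq_norm_liftExponent_sub_le)

variable {P : Params} {t : ℕ}

/-! ## §1 One fine position -/

/-- ★★ **ONE FINE POSITION, RELATIVE**: for two coarse fields with `arc X ≤ s`, `arc X̃ ≤ s̃` (`s, s̃ ≤ 1∕4`), their hat lifts `V, Ṽ` and the exponent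
difference `δ b := Σ_e w b e • L⁻¹ • (log X e − log X̃ e)`,
`dist1 ((R_{μκ}Ṽ(x))⁻¹ · R_{μκ}V(x))² ≤ 2·‖δ⟨x,μ⟩ + δ⟨x+μ,κ⟩ − δ⟨x+κ,μ⟩ − δ⟨x,κ⟩‖² + 128·(L⁻¹)²·(s+s̃)²·Σ_{i=1}^{4} ‖δ b_i‖²`. [cite: Balaban1985Variational, (34) p.283] -/
theorem dist1_rect_rel_lift_sq_le (ht : t + 1 ≤ P.m + P.K) (w : PBond P t → PBond P (t + 1) → ℝ)
    (hw : ∀ b e, w b e = if e.dir = b.dir ∧ (b.src b.dir - emb e.src b.dir).val < P.L then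
      ∏ ν ∈ Finset.univ.erase b.dir, max 0 (1 - ((rel (emb e.src) b.src ν).natAbs : ℝ) / P.L) else 0)
    (X X' : GaugeField P (t + 1) SU2) (V V' : GaugeField P t SU2)
    (hV : ∀ b, V b = expPoint (∑ e, w b e • ((P.L : ℝ)⁻¹ • logVec (su2Quat (X e)))))
    (hV' : ∀ b, V' b = expPoint (∑ e, w b e • ((P.L : ℝ)⁻¹ • logVec (su2Quat (X' e)))))
    {s s' : ℝ} (hs : ∀ e, ‖logVec (su2Quat (X e))‖ ≤ s) (hs' : ∀ e, ‖logVec (su2Quat (X' e))‖ ≤ s') (hs4 : s ≤ 1 / 4) (hs4' : s' ≤ 1 / 4)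
    (x : Site P t) (μ κ : Fin P.d) :
    dist1 ((rect V' x μ κ 1 1)⁻¹ * rect V x μ κ 1 1) ^ 2 ≤
      2 * ‖(∑ e, w ⟨x, μ⟩ e • ((P.L : ℝ)⁻¹ • (logVec (su2Quat (X e)) - logVec (su2Quat (X' e)))))
            + (∑ e, w ⟨x.shift μ, κ⟩ e • ((P.L : ℝ)⁻¹ • (logVec (su2Quat (X e)) - logVec (su2Quat (X' e)))))
            - (∑ e, w ⟨x.shift κ, μ⟩ e • ((P.L : ℝ)⁻¹ • (logVec (su2Quat (X e)) - logVec (su2Quat (X' e)))))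
            - (∑ e, w ⟨x, κ⟩ e • ((P.L : ℝ)⁻¹ • (logVec (su2Quat (X e)) - logVec (su2Quat (X' e)))))‖ ^ 2 +
      128 * ((P.L : ℝ)⁻¹) ^ 2 * (s + s') ^ 2 *
        (‖∑ e, w ⟨x, μ⟩ e • ((P.L : ℝ)⁻¹ • (logVec (su2Quat (X e)) - logVec (su2Quat (X' e))))‖ ^ 2
          + ‖∑ e, w ⟨x.shift μ, κ⟩ e • ((P.L : ℝ)⁻¹ • (logVec (su2Quat (X e)) - logVec (su2Quat (X' e))))‖ ^ 2
          + ‖∑ e, w ⟨x.shift κ, μ⟩ e • ((P.L : ℝ)⁻¹ • (logVec (su2Quat (X e)) - logVec (su2Quat (X' e))))‖ ^ 2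
          + ‖∑ e, w ⟨x, κ⟩ e • ((P.L : ℝ)⁻¹ • (logVec (su2Quat (X e)) - logVec (su2Quat (X' e))))‖ ^ 2) := by
  have hsq : ∀ u v : ℝ, (u + v) ^ 2 ≤ 2 * u ^ 2 + 2 * v ^ 2 := fun u v => by nlinarith [sq_nonneg (u - v)]
  -- (`(Σ_4 u)² ≤ 4 Σ u²`, Cauchy–Schwarz; = lit ✓`MatomakiRadziwillThm3.sq_add_four_le`, restated inline to keep this file's imports inside the S2β lineage)
  have sq_add_four_le : ∀ u₁ u₂ u₃ u₄ : ℝ, (u₁ + u₂ + u₃ + u₄) ^ 2 ≤ 4 * (u₁ ^ 2 + u₂ ^ 2 + u₃ ^ 2 + u₄ ^ 2) := fun u₁ u₂ u₃ u₄ => by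
    nlinarith [sq_nonneg (u₁ - u₂), sq_nonneg (u₁ - u₃), sq_nonneg (u₁ - u₄), sq_nonneg (u₂ - u₃), sq_nonneg (u₂ - u₄), sq_nonneg (u₃ - u₄)]
  have hL1 : (1 : ℝ) ≤ P.L := by exact_mod_cast P.L_pos
  have hLinv0 : 0 ≤ (P.L : ℝ)⁻¹ := inv_nonneg.mpr (Nat.cast_nonneg _)
  have hLinv : (P.L : ℝ)⁻¹ ≤ 1 := inv_le_one_of_one_le₀ hL1
  have hs0 : 0 ≤ s := (norm_nonneg _).trans (hs ⟨blockOf x, μ⟩)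
  have hs0' : 0 ≤ s' := (norm_nonneg _).trans (hs' ⟨blockOf x, μ⟩)
  -- the exponent fields and their difference
  set a : PBond P t → EuclideanSpace ℝ (Fin 3) := fun b => ∑ e, w b e • ((P.L : ℝ)⁻¹ • logVec (su2Quat (X e))) with ha
  set a' : PBond P t → EuclideanSpace ℝ (Fin 3) := fun b => ∑ e, w b e • ((P.L : ℝ)⁻¹ • logVec (su2Quat (X' e))) with ha'
  set δ : PBond P t → EuclideanSpace ℝ (Fin 3) := fun b => ∑ e, w b e • ((P.L : ℝ)⁻¹ • (logVec (su2Quat (X e)) - logVec (su2Quat (X' e))))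
    with hδ
  have hδab : ∀ b, a b - a' b = δ b := fun b => liftExponent_sub w X X' b
  have hVa : ∀ b, V b = expPoint (a b) := fun b => by rw [hV]
  have hVa' : ∀ b, V' b = expPoint (a' b) := fun b => by rw [hV']
  have haL : ∀ b, ‖a b‖ ≤ (P.L : ℝ)⁻¹ * s := fun b =>
    norm_sum_smul_le_of_forall_le Finset.univ (fun e _ => hatW_nonneg w hw b e) (sum_hatW_eq_one ht w hw b) fun e _ => by
      rw [norm_smul, Real.norm_eq_abs, abs_of_nonneg hLinv0]; exact mul_le_mul_of_nonneg_left (hs e) hLinv0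
  have haL' : ∀ b, ‖a' b‖ ≤ (P.L : ℝ)⁻¹ * s' := fun b =>
    norm_sum_smul_le_of_forall_le Finset.univ (fun e _ => hatW_nonneg w hw b e) (sum_hatW_eq_one ht w hw b) fun e _ => by
      rw [norm_smul, Real.norm_eq_abs, abs_of_nonneg hLinv0]; exact mul_le_mul_of_nonneg_left (hs' e) hLinv0
  have hτ4 : (P.L : ℝ)⁻¹ * s ≤ 1 / 4 := (mul_le_of_le_one_left hs0 hLinv).trans hs4
  have hτ4' : (P.L : ℝ)⁻¹ * s' ≤ 1 / 4 := (mul_le_of_le_one_left hs0' hLinv).trans hs4'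
  -- the relative four-factor expansion at this position
  have h1 : dist1 ((rect V' x μ κ 1 1)⁻¹ * rect V x μ κ 1 1) ≤
      ‖(a ⟨x, μ⟩ + a ⟨x.shift μ, κ⟩ - a ⟨x.shift κ, μ⟩ - a ⟨x, κ⟩) - (a' ⟨x, μ⟩ + a' ⟨x.shift μ, κ⟩ - a' ⟨x.shift κ, μ⟩ - a' ⟨x, κ⟩)‖ +
        4 * ((P.L : ℝ)⁻¹ * s + (P.L : ℝ)⁻¹ * s') *
          (‖a ⟨x, μ⟩ - a' ⟨x, μ⟩‖ + ‖a ⟨x.shift μ, κ⟩ - a' ⟨x.shift μ, κ⟩‖ + ‖a ⟨x.shift κ, μ⟩ - a' ⟨x.shift κ, μ⟩‖ + ‖a ⟨x, κ⟩ - a' ⟨x, κ⟩‖) := by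
    rw [rect_one_one_eq, rect_one_one_eq, hVa, hVa, hVa, hVa, hVa', hVa', hVa', hVa']
    exact dist1_plaq4_rel_le (haL _) (haL _) (haL _) (haL _) (haL' _) (haL' _) (haL' _) (haL' _) hτ4 hτ4'
  have hlin : (a ⟨x, μ⟩ + a ⟨x.shift μ, κ⟩ - a ⟨x.shift κ, μ⟩ - a ⟨x, κ⟩) - (a' ⟨x, μ⟩ + a' ⟨x.shift μ, κ⟩ - a' ⟨x.shift κ, μ⟩ - a' ⟨x, κ⟩)
      = δ ⟨x, μ⟩ + δ ⟨x.shift μ, κ⟩ - δ ⟨x.shift κ, μ⟩ - δ ⟨x, κ⟩ := by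
    rw [← hδab, ← hδab, ← hδab, ← hδab]; abel
  rw [hlin, hδab, hδab, hδab, hδab] at h1
  -- square
  set D : ℝ := ‖δ ⟨x, μ⟩ + δ ⟨x.shift μ, κ⟩ - δ ⟨x.shift κ, μ⟩ - δ ⟨x, κ⟩‖ with hD
  set Sd : ℝ := ‖δ ⟨x, μ⟩‖ + ‖δ ⟨x.shift μ, κ⟩‖ + ‖δ ⟨x.shift κ, μ⟩‖ + ‖δ ⟨x, κ⟩‖ with hSd
  set Q : ℝ := ‖δ ⟨x, μ⟩‖ ^ 2 + ‖δ ⟨x.shift μ, κ⟩‖ ^ 2 + ‖δ ⟨x.shift κ, μ⟩‖ ^ 2 + ‖δ ⟨x, κ⟩‖ ^ 2 with hQ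
  have hSQ : Sd ^ 2 ≤ 4 * Q := sq_add_four_le _ _ _ _
  have hd0 : 0 ≤ dist1 ((rect V' x μ κ 1 1)⁻¹ * rect V x μ κ 1 1) := GaugeGroup.dist1_nonneg _
  have hτsum : 4 * ((P.L : ℝ)⁻¹ * s + (P.L : ℝ)⁻¹ * s') = 4 * (P.L : ℝ)⁻¹ * (s + s') := by ring
  rw [hτsum] at h1
  have hrem : (4 * (P.L : ℝ)⁻¹ * (s + s') * Sd) ^ 2 ≤ 64 * ((P.L : ℝ)⁻¹) ^ 2 * (s + s') ^ 2 * Q := by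
    have h0 : 0 ≤ 16 * ((P.L : ℝ)⁻¹) ^ 2 * (s + s') ^ 2 := by positivity
    calc (4 * (P.L : ℝ)⁻¹ * (s + s') * Sd) ^ 2 = 16 * ((P.L : ℝ)⁻¹) ^ 2 * (s + s') ^ 2 * Sd ^ 2 := by ring
      _ ≤ 16 * ((P.L : ℝ)⁻¹) ^ 2 * (s + s') ^ 2 * (4 * Q) := mul_le_mul_of_nonneg_left hSQ h0
      _ = _ := by ring
  calc dist1 ((rect V' x μ κ 1 1)⁻¹ * rect V x μ κ 1 1) ^ 2 ≤ (D + 4 * (P.L : ℝ)⁻¹ * (s + s') * Sd) ^ 2 := pow_le_pow_left₀ hd0 h1 2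
    _ ≤ 2 * D ^ 2 + 2 * (4 * (P.L : ℝ)⁻¹ * (s + s') * Sd) ^ 2 := hsq _ _
    _ ≤ 2 * D ^ 2 + 2 * (64 * ((P.L : ℝ)⁻¹) ^ 2 * (s + s') ^ 2 * Q) := add_le_add le_rfl (mul_le_mul_of_nonneg_left hrem (by norm_num))
    _ = _ := by rw [hQ]; ring


/-! ## §2 One coarse position -/

/-- ★★ **ONE COARSE POSITION, RELATIVE**: with `Δ e := log X e − log X̃ e` and `arc X ≤ s`, `arc X̃ ≤ s̃` (`s, s̃ ≤ 1∕4`), the linearised curl of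
`L⁻¹ • Δ` around `(y; μ,κ)` has `‖d(L⁻¹Δ)(y)‖² ≤ (L⁻¹)²·(2·dist1((R_{μκ}X̃(y))⁻¹·R_{μκ}X(y))² + 128·(s+s̃)²·Σ_{edges} ‖Δ‖²)`
(✓`norm_lincurl_sub_le_dist1_rel_add` at the coarse level). [cite: Balaban1985Variational, (34) p.283] -/
theorem sq_norm_lincurl_rel_coarse_le (X X' : GaugeField P (t + 1) SU2) {s s' : ℝ}
    (hs : ∀ e, ‖logVec (su2Quat (X e))‖ ≤ s) (hs' : ∀ e, ‖logVec (su2Quat (X' e))‖ ≤ s') (hs4 : s ≤ 1 / 4) (hs4' : s' ≤ 1 / 4)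
    (y : Site P (t + 1)) (μ κ : Fin P.d) :
    ‖(P.L : ℝ)⁻¹ • (logVec (su2Quat (X ⟨y, μ⟩)) - logVec (su2Quat (X' ⟨y, μ⟩)))
        + (P.L : ℝ)⁻¹ • (logVec (su2Quat (X ⟨y.shift μ, κ⟩)) - logVec (su2Quat (X' ⟨y.shift μ, κ⟩)))
        - (P.L : ℝ)⁻¹ • (logVec (su2Quat (X ⟨y.shift κ, μ⟩)) - logVec (su2Quat (X' ⟨y.shift κ, μ⟩)))
        - (P.L : ℝ)⁻¹ • (logVec (su2Quat (X ⟨y, κ⟩)) - logVec (su2Quat (X' ⟨y, κ⟩)))‖ ^ 2 ≤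
      ((P.L : ℝ)⁻¹) ^ 2 * (2 * dist1 ((rect X' y μ κ 1 1)⁻¹ * rect X y μ κ 1 1) ^ 2 + 128 * (s + s') ^ 2 *
        (‖logVec (su2Quat (X ⟨y, μ⟩)) - logVec (su2Quat (X' ⟨y, μ⟩))‖ ^ 2
          + ‖logVec (su2Quat (X ⟨y.shift μ, κ⟩)) - logVec (su2Quat (X' ⟨y.shift μ, κ⟩))‖ ^ 2
          + ‖logVec (su2Quat (X ⟨y.shift κ, μ⟩)) - logVec (su2Quat (X' ⟨y.shift κ, μ⟩))‖ ^ 2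
          + ‖logVec (su2Quat (X ⟨y, κ⟩)) - logVec (su2Quat (X' ⟨y, κ⟩))‖ ^ 2)) := by
  have hsq : ∀ u v : ℝ, (u + v) ^ 2 ≤ 2 * u ^ 2 + 2 * v ^ 2 := fun u v => by nlinarith [sq_nonneg (u - v)]
  -- (`(Σ_4 u)² ≤ 4 Σ u²`, Cauchy–Schwarz; = lit ✓`MatomakiRadziwillThm3.sq_add_four_le`, restated inline to keep this file's imports inside the S2β lineage)
  have sq_add_four_le : ∀ u₁ u₂ u₃ u₄ : ℝ, (u₁ + u₂ + u₃ + u₄) ^ 2 ≤ 4 * (u₁ ^ 2 + u₂ ^ 2 + u₃ ^ 2 + u₄ ^ 2) := fun u₁ u₂ u₃ u₄ => by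
    nlinarith [sq_nonneg (u₁ - u₂), sq_nonneg (u₁ - u₃), sq_nonneg (u₁ - u₄), sq_nonneg (u₂ - u₃), sq_nonneg (u₂ - u₄), sq_nonneg (u₃ - u₄)]
  have h := norm_lincurl_sub_le_dist1_rel_add (hs ⟨y, μ⟩) (hs ⟨y.shift μ, κ⟩) (hs ⟨y.shift κ, μ⟩) (hs ⟨y, κ⟩)
    (hs' ⟨y, μ⟩) (hs' ⟨y.shift μ, κ⟩) (hs' ⟨y.shift κ, μ⟩) (hs' ⟨y, κ⟩) hs4 hs4'
  rw [expPoint_logVec, expPoint_logVec, expPoint_logVec, expPoint_logVec, expPoint_logVec, expPoint_logVec, expPoint_logVec,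
    expPoint_logVec, ← rect_one_one_eq X y μ κ, ← rect_one_one_eq X' y μ κ] at h
  set D := dist1 ((rect X' y μ κ 1 1)⁻¹ * rect X y μ κ 1 1) with hD
  set d1 := ‖logVec (su2Quat (X ⟨y, μ⟩)) - logVec (su2Quat (X' ⟨y, μ⟩))‖
  set d2 := ‖logVec (su2Quat (X ⟨y.shift μ, κ⟩)) - logVec (su2Quat (X' ⟨y.shift μ, κ⟩))‖
  set d3 := ‖logVec (su2Quat (X ⟨y.shift κ, μ⟩)) - logVec (su2Quat (X' ⟨y.shift κ, μ⟩))‖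
  set d4 := ‖logVec (su2Quat (X ⟨y, κ⟩)) - logVec (su2Quat (X' ⟨y, κ⟩))‖
  have hlin : (logVec (su2Quat (X ⟨y, μ⟩)) + logVec (su2Quat (X ⟨y.shift μ, κ⟩)) - logVec (su2Quat (X ⟨y.shift κ, μ⟩)) - logVec (su2Quat (X ⟨y, κ⟩)))
      - (logVec (su2Quat (X' ⟨y, μ⟩)) + logVec (su2Quat (X' ⟨y.shift μ, κ⟩)) - logVec (su2Quat (X' ⟨y.shift κ, μ⟩)) - logVec (su2Quat (X' ⟨y, κ⟩)))
      = (logVec (su2Quat (X ⟨y, μ⟩)) - logVec (su2Quat (X' ⟨y, μ⟩))) + (logVec (su2Quat (X ⟨y.shift μ, κ⟩)) - logVec (su2Quat (X' ⟨y.shift μ, κ⟩)))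
        - (logVec (su2Quat (X ⟨y.shift κ, μ⟩)) - logVec (su2Quat (X' ⟨y.shift κ, μ⟩))) - (logVec (su2Quat (X ⟨y, κ⟩)) - logVec (su2Quat (X' ⟨y, κ⟩))) := by
    abel
  rw [hlin] at h
  have hlin0 := norm_nonneg ((logVec (su2Quat (X ⟨y, μ⟩)) - logVec (su2Quat (X' ⟨y, μ⟩))) + (logVec (su2Quat (X ⟨y.shift μ, κ⟩)) - logVec (su2Quat (X' ⟨y.shift μ, κ⟩)))
        - (logVec (su2Quat (X ⟨y.shift κ, μ⟩)) - logVec (su2Quat (X' ⟨y.shift κ, μ⟩))) - (logVec (su2Quat (X ⟨y, κ⟩)) - logVec (su2Quat (X' ⟨y, κ⟩))))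
  have hS : (d1 + d2 + d3 + d4) ^ 2 ≤ 4 * (d1 ^ 2 + d2 ^ 2 + d3 ^ 2 + d4 ^ 2) := sq_add_four_le _ _ _ _
  have hrem : (4 * (s + s') * (d1 + d2 + d3 + d4)) ^ 2 ≤ 64 * (s + s') ^ 2 * (d1 ^ 2 + d2 ^ 2 + d3 ^ 2 + d4 ^ 2) := by
    have h0 : 0 ≤ 16 * (s + s') ^ 2 := by positivity
    calc (4 * (s + s') * (d1 + d2 + d3 + d4)) ^ 2 = 16 * (s + s') ^ 2 * (d1 + d2 + d3 + d4) ^ 2 := by ring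
      _ ≤ 16 * (s + s') ^ 2 * (4 * (d1 ^ 2 + d2 ^ 2 + d3 ^ 2 + d4 ^ 2)) := mul_le_mul_of_nonneg_left hS h0
      _ = _ := by ring
  rw [← smul_add, ← smul_sub, ← smul_sub, norm_smul, mul_pow, Real.norm_eq_abs, sq_abs]
  refine mul_le_mul_of_nonneg_left ?_ (sq_nonneg _)
  calc _ ≤ (D + 4 * (s + s') * (d1 + d2 + d3 + d4)) ^ 2 := pow_le_pow_left₀ hlin0 h 2
    _ ≤ 2 * D ^ 2 + 2 * (4 * (s + s') * (d1 + d2 + d3 + d4)) ^ 2 := hsq _ _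
    _ ≤ 2 * D ^ 2 + 2 * (64 * (s + s') ^ 2 * (d1 ^ 2 + d2 ^ 2 + d3 ^ 2 + d4 ^ 2)) :=
        add_le_add le_rfl (mul_le_mul_of_nonneg_left hrem (by norm_num))
    _ = _ := by ring

/-! ## §3 One ordered pair of directions, summed over the positions of the level -/

/-- ★★★ **ONE PLANE, ONE LEVEL, RELATIVE, IN `ℓ²`**: for `μ ≠ κ`, with `E_x := (R_{μκ}Ṽ(x))⁻¹·R_{μκ}V(x)` (fine) and `E_y := (R_{μκ}X̃(y))⁻¹·R_{μκ}X(y)` (coarse),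
`Σ_x dist1(E_x)² ≤ (L⁻¹)²·L^d·(L⁻¹)²·(4·Σ_y dist1(E_y)² + 512·(s+s̃)²·Σ_y (‖Δ⟨y,μ⟩‖² + ‖Δ⟨y,κ⟩‖²)) + 256·(L⁻¹)²·(s+s̃)²·Σ_x (‖δ⟨x,μ⟩‖² + ‖δ⟨x,κ⟩‖²)`
— FLUX-rel with the `L^{d−4}` gain + SIZE² × DIFFERENCE² terms (coarse `Δ e = log X e − log X̃ e`, fine `δ b` = the lifted difference). [cite: Balaban1985RegularSpaces, (1.29) p.81] -/
theorem sum_dist1_rect_rel_lift_sq_le (ht : t + 1 ≤ P.m + P.K) (w : PBond P t → PBond P (t + 1) → ℝ)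
    (hw : ∀ b e, w b e = if e.dir = b.dir ∧ (b.src b.dir - emb e.src b.dir).val < P.L then
      ∏ ν ∈ Finset.univ.erase b.dir, max 0 (1 - ((rel (emb e.src) b.src ν).natAbs : ℝ) / P.L) else 0)
    (X X' : GaugeField P (t + 1) SU2) (V V' : GaugeField P t SU2)
    (hV : ∀ b, V b = expPoint (∑ e, w b e • ((P.L : ℝ)⁻¹ • logVec (su2Quat (X e)))))
    (hV' : ∀ b, V' b = expPoint (∑ e, w b e • ((P.L : ℝ)⁻¹ • logVec (su2Quat (X' e)))))
    {s s' : ℝ} (hs : ∀ e, ‖logVec (su2Quat (X e))‖ ≤ s) (hs' : ∀ e, ‖logVec (su2Quat (X' e))‖ ≤ s') (hs4 : s ≤ 1 / 4) (hs4' : s' ≤ 1 / 4)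
    {μ κ : Fin P.d} (hμκ : μ ≠ κ) :
    ∑ x : Site P t, dist1 ((rect V' x μ κ 1 1)⁻¹ * rect V x μ κ 1 1) ^ 2 ≤
      ((P.L : ℝ)⁻¹) ^ 2 * (P.L : ℝ) ^ P.d * (((P.L : ℝ)⁻¹) ^ 2 *
        (4 * ∑ y : Site P (t + 1), dist1 ((rect X' y μ κ 1 1)⁻¹ * rect X y μ κ 1 1) ^ 2 +
          512 * (s + s') ^ 2 * ∑ y : Site P (t + 1), (‖logVec (su2Quat (X ⟨y, μ⟩)) - logVec (su2Quat (X' ⟨y, μ⟩))‖ ^ 2 +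
            ‖logVec (su2Quat (X ⟨y, κ⟩)) - logVec (su2Quat (X' ⟨y, κ⟩))‖ ^ 2))) +
      256 * ((P.L : ℝ)⁻¹) ^ 2 * (s + s') ^ 2 * ∑ x : Site P t,
        (‖∑ e, w ⟨x, μ⟩ e • ((P.L : ℝ)⁻¹ • (logVec (su2Quat (X e)) - logVec (su2Quat (X' e))))‖ ^ 2 +
          ‖∑ e, w ⟨x, κ⟩ e • ((P.L : ℝ)⁻¹ • (logVec (su2Quat (X e)) - logVec (su2Quat (X' e))))‖ ^ 2) := by
  have h1 := fun x => dist1_rect_rel_lift_sq_le ht w hw X X' V V' hV hV' hs hs' hs4 hs4' x μ κ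
  -- the fine difference field `δ` and the coarse form `A = L⁻¹ • Δ`
  set δ : PBond P t → EuclideanSpace ℝ (Fin 3) := fun b => ∑ e, w b e • ((P.L : ℝ)⁻¹ • (logVec (su2Quat (X e)) - logVec (su2Quat (X' e))))
    with hδ
  set A : PBond P (t + 1) → EuclideanSpace ℝ (Fin 3) := fun e => (P.L : ℝ)⁻¹ • (logVec (su2Quat (X e)) - logVec (su2Quat (X' e))) with hA
  have hcurl := sum_sq_norm_lincurl_hat_le ht w hw A δ (fun _ => rfl) hμκ
  have h2 := fun y => sq_norm_lincurl_rel_coarse_le X X' hs hs' hs4 hs4' y μ κ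
  have hL2 : 0 ≤ ((P.L : ℝ)⁻¹) ^ 2 * (P.L : ℝ) ^ P.d := by positivity
  set Δ : PBond P (t + 1) → ℝ := fun e => ‖logVec (su2Quat (X e)) - logVec (su2Quat (X' e))‖ ^ 2 with hΔ
  calc ∑ x : Site P t, dist1 ((rect V' x μ κ 1 1)⁻¹ * rect V x μ κ 1 1) ^ 2
      ≤ ∑ x : Site P t, (2 * ‖δ ⟨x, μ⟩ + δ ⟨x.shift μ, κ⟩ - δ ⟨x.shift κ, μ⟩ - δ ⟨x, κ⟩‖ ^ 2 +
          128 * ((P.L : ℝ)⁻¹) ^ 2 * (s + s') ^ 2 * (‖δ ⟨x, μ⟩‖ ^ 2 + ‖δ ⟨x.shift μ, κ⟩‖ ^ 2 + ‖δ ⟨x.shift κ, μ⟩‖ ^ 2 + ‖δ ⟨x, κ⟩‖ ^ 2)) :=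
        Finset.sum_le_sum fun x _ => h1 x
    _ = 2 * ∑ x : Site P t, ‖δ ⟨x, μ⟩ + δ ⟨x.shift μ, κ⟩ - δ ⟨x.shift κ, μ⟩ - δ ⟨x, κ⟩‖ ^ 2 +
          128 * ((P.L : ℝ)⁻¹) ^ 2 * (s + s') ^ 2 * (2 * ∑ x : Site P t, (‖δ ⟨x, μ⟩‖ ^ 2 + ‖δ ⟨x, κ⟩‖ ^ 2)) := by
        rw [Finset.sum_add_distrib, ← Finset.mul_sum, ← Finset.mul_sum, sum_four_slots_eq (fun b => ‖δ b‖ ^ 2) μ κ]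
    _ ≤ 2 * (((P.L : ℝ)⁻¹) ^ 2 * (P.L : ℝ) ^ P.d * ∑ y : Site P (t + 1), ‖A ⟨y, μ⟩ + A ⟨y.shift μ, κ⟩ - A ⟨y.shift κ, μ⟩ - A ⟨y, κ⟩‖ ^ 2) +
          128 * ((P.L : ℝ)⁻¹) ^ 2 * (s + s') ^ 2 * (2 * ∑ x : Site P t, (‖δ ⟨x, μ⟩‖ ^ 2 + ‖δ ⟨x, κ⟩‖ ^ 2)) := by
        gcongr
    _ ≤ 2 * (((P.L : ℝ)⁻¹) ^ 2 * (P.L : ℝ) ^ P.d * ∑ y : Site P (t + 1), ((P.L : ℝ)⁻¹) ^ 2 *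
          (2 * dist1 ((rect X' y μ κ 1 1)⁻¹ * rect X y μ κ 1 1) ^ 2 + 128 * (s + s') ^ 2 *
            (Δ ⟨y, μ⟩ + Δ ⟨y.shift μ, κ⟩ + Δ ⟨y.shift κ, μ⟩ + Δ ⟨y, κ⟩))) +
          128 * ((P.L : ℝ)⁻¹) ^ 2 * (s + s') ^ 2 * (2 * ∑ x : Site P t, (‖δ ⟨x, μ⟩‖ ^ 2 + ‖δ ⟨x, κ⟩‖ ^ 2)) := by
        gcongr with y _
        exact h2 y
    _ = _ := by
        have hE := sum_four_slots_eq Δ μ κ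
        have hinner : ∑ y : Site P (t + 1), ((P.L : ℝ)⁻¹) ^ 2 *
            (2 * dist1 ((rect X' y μ κ 1 1)⁻¹ * rect X y μ κ 1 1) ^ 2 + 128 * (s + s') ^ 2 * (Δ ⟨y, μ⟩ + Δ ⟨y.shift μ, κ⟩ + Δ ⟨y.shift κ, μ⟩ + Δ ⟨y, κ⟩))
            = ((P.L : ℝ)⁻¹) ^ 2 * (2 * ∑ y : Site P (t + 1), dist1 ((rect X' y μ κ 1 1)⁻¹ * rect X y μ κ 1 1) ^ 2 +
              128 * (s + s') ^ 2 * (2 * ∑ y : Site P (t + 1), (Δ ⟨y, μ⟩ + Δ ⟨y, κ⟩))) := by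
          rw [← hE, ← Finset.mul_sum, Finset.sum_add_distrib, ← Finset.mul_sum, ← Finset.mul_sum]
        rw [hinner]
        ring


/-! ## §4 All ordered pairs of directions: the level in `ℓ²` -/

/-- ★★★ **THE RELATIVE CURVATURE OF TWO HAT LIFTS IN `ℓ²` OVER A LEVEL** (all ordered plaquette positions): with `Δ e := log X e − log X̃ e`,
`Σ_{(x;μ≠κ)} dist1((R_{μκ}Ṽ(x))⁻¹·R_{μκ}V(x))² ≤ (L⁻¹)⁴·L^d·(4·Σ_{(y;μ≠κ)} dist1((R_{μκ}X̃(y))⁻¹·R_{μκ}X(y))² + 1536·(d−1)·(s+s̃)²·Σ_e ‖Δ e‖²)`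
— the `L^{d−4}` (= `L⁻¹` at `d = 3`) GAIN on the coarse RELATIVE FLUX plus SIZE² × DIFFERENCE² linear in `‖Δ‖²_{ℓ²}` (the two-tower recursion's `√L·ε_t·D_{t+1}` slot,
`ε_t ∝ (s_t + s̃_t)∕√L` summable). [cite: Balaban1985RegularSpaces, (1.29) p.81] -/
theorem sum_positions_dist1_rel_lift_sq_le (ht : t + 1 ≤ P.m + P.K) (w : PBond P t → PBond P (t + 1) → ℝ)
    (hw : ∀ b e, w b e = if e.dir = b.dir ∧ (b.src b.dir - emb e.src b.dir).val < P.L then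
      ∏ ν ∈ Finset.univ.erase b.dir, max 0 (1 - ((rel (emb e.src) b.src ν).natAbs : ℝ) / P.L) else 0)
    (X X' : GaugeField P (t + 1) SU2) (V V' : GaugeField P t SU2)
    (hV : ∀ b, V b = expPoint (∑ e, w b e • ((P.L : ℝ)⁻¹ • logVec (su2Quat (X e)))))
    (hV' : ∀ b, V' b = expPoint (∑ e, w b e • ((P.L : ℝ)⁻¹ • logVec (su2Quat (X' e)))))
    {s s' : ℝ} (hs : ∀ e, ‖logVec (su2Quat (X e))‖ ≤ s) (hs' : ∀ e, ‖logVec (su2Quat (X' e))‖ ≤ s') (hs4 : s ≤ 1 / 4) (hs4' : s' ≤ 1 / 4) :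
    ∑ q ∈ (Finset.univ : Finset (Site P t × Fin P.d × Fin P.d)).filter (fun q => q.2.1 ≠ q.2.2),
        dist1 ((rect V' q.1 q.2.1 q.2.2 1 1)⁻¹ * rect V q.1 q.2.1 q.2.2 1 1) ^ 2 ≤
      (((P.L : ℝ)⁻¹) ^ 2) ^ 2 * (P.L : ℝ) ^ P.d *
        (4 * ∑ q ∈ (Finset.univ : Finset (Site P (t + 1) × Fin P.d × Fin P.d)).filter (fun q => q.2.1 ≠ q.2.2),
            dist1 ((rect X' q.1 q.2.1 q.2.2 1 1)⁻¹ * rect X q.1 q.2.1 q.2.2 1 1) ^ 2 +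
          1536 * ((P.d : ℝ) - 1) * (s + s') ^ 2 * ∑ e, ‖logVec (su2Quat (X e)) - logVec (su2Quat (X' e))‖ ^ 2) := by
  -- per plane
  have hplane := fun (μ κ : Fin P.d) (hμκ : μ ≠ κ) => sum_dist1_rect_rel_lift_sq_le ht w hw X X' V V' hV hV' hs hs' hs4 hs4' hμκ
  set Δ : PBond P (t + 1) → ℝ := fun e => ‖logVec (su2Quat (X e)) - logVec (su2Quat (X' e))‖ ^ 2 with hΔ
  have hexp : ∀ b : PBond P t, ‖∑ e, w b e • ((P.L : ℝ)⁻¹ • (logVec (su2Quat (X e)) - logVec (su2Quat (X' e))))‖ ^ 2 ≤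
      ((P.L : ℝ)⁻¹) ^ 2 * ∑ e, w b e * Δ e := fun b => by
    rw [← liftExponent_sub w X X' b]
    exact sq_norm_liftExponent_sub_le ht w hw X X' b
  -- `Σ_b Σ_e w b e·G e = L^d·Σ_e G e` (✓`sum_sum_hatW_mul_eq`, two lines, restated inline)
  have hmass : ∀ G : PBond P (t + 1) → ℝ, ∑ b : PBond P t, ∑ e, w b e * G e = (P.L : ℝ) ^ P.d * ∑ e, G e := fun G => by
    rw [Finset.sum_comm, Finset.mul_sum]
    exact Finset.sum_congr rfl fun e _ => by rw [← Finset.sum_mul, sum_hatW_eq_pow ht w hw e]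
  -- the two SIZE² sums over the planes
  have eP : ∑ p ∈ (Finset.univ : Finset (Fin P.d × Fin P.d)).filter (fun p => p.1 ≠ p.2),
      ∑ y : Site P (t + 1), (Δ ⟨y, p.1⟩ + Δ ⟨y, p.2⟩) = 2 * ((P.d : ℝ) - 1) * ∑ e : PBond P (t + 1), Δ e := by
    calc _ = ∑ p ∈ (Finset.univ : Finset (Fin P.d × Fin P.d)).filter (fun p => p.1 ≠ p.2),
          ((∑ y : Site P (t + 1), Δ ⟨y, p.1⟩) + ∑ y : Site P (t + 1), Δ ⟨y, p.2⟩) :=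
          Finset.sum_congr rfl fun p _ => Finset.sum_add_distrib
      _ = 2 * ((P.d : ℝ) - 1) * ∑ μ : Fin P.d, ∑ y : Site P (t + 1), Δ ⟨y, μ⟩ := sum_pairs_add_eq (fun μ => ∑ y : Site P (t + 1), Δ ⟨y, μ⟩)
      _ = _ := by
          rw [FluctuationComparisonRegPrIntLS2BetaWhitneyHatWeights.sum_pbond (fun e : PBond P (t + 1) => Δ e), Finset.sum_comm]
  have eQ : ∑ p ∈ (Finset.univ : Finset (Fin P.d × Fin P.d)).filter (fun p => p.1 ≠ p.2),
      ∑ x : Site P t, (∑ e, w ⟨x, p.1⟩ e * Δ e + ∑ e, w ⟨x, p.2⟩ e * Δ e) = 2 * ((P.d : ℝ) - 1) * ((P.L : ℝ) ^ P.d * ∑ e : PBond P (t + 1), Δ e) := by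
    calc _ = ∑ p ∈ (Finset.univ : Finset (Fin P.d × Fin P.d)).filter (fun p => p.1 ≠ p.2),
          ((∑ x : Site P t, ∑ e, w ⟨x, p.1⟩ e * Δ e) + ∑ x : Site P t, ∑ e, w ⟨x, p.2⟩ e * Δ e) :=
          Finset.sum_congr rfl fun p _ => Finset.sum_add_distrib
      _ = 2 * ((P.d : ℝ) - 1) * ∑ μ : Fin P.d, ∑ x : Site P t, ∑ e, w ⟨x, μ⟩ e * Δ e := sum_pairs_add_eq (fun μ => ∑ x : Site P t, ∑ e, w ⟨x, μ⟩ e * Δ e)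
      _ = _ := by
          rw [← hmass, FluctuationComparisonRegPrIntLS2BetaWhitneyHatWeights.sum_pbond (fun b : PBond P t => ∑ e, w b e * Δ e), Finset.sum_comm]
  rw [sum_positions_eq, sum_positions_eq]
  calc ∑ p ∈ (Finset.univ : Finset (Fin P.d × Fin P.d)).filter (fun p => p.1 ≠ p.2), ∑ x : Site P t, dist1 ((rect V' x p.1 p.2 1 1)⁻¹ * rect V x p.1 p.2 1 1) ^ 2
      ≤ ∑ p ∈ (Finset.univ : Finset (Fin P.d × Fin P.d)).filter (fun p => p.1 ≠ p.2),
          (((P.L : ℝ)⁻¹) ^ 2 * (P.L : ℝ) ^ P.d * (((P.L : ℝ)⁻¹) ^ 2 *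
            (4 * ∑ y : Site P (t + 1), dist1 ((rect X' y p.1 p.2 1 1)⁻¹ * rect X y p.1 p.2 1 1) ^ 2 +
              512 * (s + s') ^ 2 * ∑ y : Site P (t + 1), (Δ ⟨y, p.1⟩ + Δ ⟨y, p.2⟩))) +
          256 * ((P.L : ℝ)⁻¹) ^ 2 * (s + s') ^ 2 * (((P.L : ℝ)⁻¹) ^ 2 * ∑ x : Site P t,
            (∑ e, w ⟨x, p.1⟩ e * Δ e + ∑ e, w ⟨x, p.2⟩ e * Δ e))) := by
        refine Finset.sum_le_sum fun p hp => ?_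
        have hμκ : p.1 ≠ p.2 := (Finset.mem_filter.mp hp).2
        have hc : (0 : ℝ) ≤ 256 * ((P.L : ℝ)⁻¹) ^ 2 * (s + s') ^ 2 := by positivity
        refine (hplane p.1 p.2 hμκ).trans (add_le_add le_rfl (mul_le_mul_of_nonneg_left ?_ hc))
        rw [Finset.mul_sum]
        exact Finset.sum_le_sum fun x _ => by rw [mul_add]; exact add_le_add (hexp _) (hexp _)
    _ = ((P.L : ℝ)⁻¹) ^ 2 * (P.L : ℝ) ^ P.d * ((P.L : ℝ)⁻¹) ^ 2 * 4 *
            ∑ p ∈ (Finset.univ : Finset (Fin P.d × Fin P.d)).filter (fun p => p.1 ≠ p.2),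
              ∑ y : Site P (t + 1), dist1 ((rect X' y p.1 p.2 1 1)⁻¹ * rect X y p.1 p.2 1 1) ^ 2 +
          ((P.L : ℝ)⁻¹) ^ 2 * (P.L : ℝ) ^ P.d * ((P.L : ℝ)⁻¹) ^ 2 * (512 * (s + s') ^ 2) *
            ∑ p ∈ (Finset.univ : Finset (Fin P.d × Fin P.d)).filter (fun p => p.1 ≠ p.2), ∑ y : Site P (t + 1), (Δ ⟨y, p.1⟩ + Δ ⟨y, p.2⟩) +
          256 * ((P.L : ℝ)⁻¹) ^ 2 * (s + s') ^ 2 * ((P.L : ℝ)⁻¹) ^ 2 *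
            ∑ p ∈ (Finset.univ : Finset (Fin P.d × Fin P.d)).filter (fun p => p.1 ≠ p.2),
              ∑ x : Site P t, (∑ e, w ⟨x, p.1⟩ e * Δ e + ∑ e, w ⟨x, p.2⟩ e * Δ e) := by
        rw [Finset.mul_sum, Finset.mul_sum, Finset.mul_sum, ← Finset.sum_add_distrib, ← Finset.sum_add_distrib]
        exact Finset.sum_congr rfl fun p _ => by ring
    _ = _ := by rw [eP, eQ]; ring

end Summit.QuantumFields.YangMills.Theorems.FluctuationComparisonRegPrIntLS2BetaWhitneyHatLiftCurvatureRelative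

end
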